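import Summits.ABC.IUTFork.Cor312LicenceTripleHullCellRefuteTameSharp
import Summits.ABC.IUTFork.Conditional.AbcOfSGenuineKLinUniformRows2
import HarnessLib

/-!
# R-W «W:LITERAL-FIVE» (b) — the triple `2⁷·23⁸ + 19⁹·857² = 3²²·13·47²·263` at the literal level `l = 5`: the hull-level clause S_H is REFUTED at
# EVERY genuine Θ-volume datum over `(ratPoint (a/c), 5)`, with NO local-type hypothesis (sharp kernel class at the tame pole `p = 19`)

PROOF-ONLY file (D-0012; 0 definitions, 0 `Prop` facts, no instance, no notation) of the abc-iut cell — D-0079 RESCUE sub-cell R-W «WINDOW Θ-SIDE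
INEQUALITY», cone prover seat abc-iut-w6-d055 (gen 12), row «W:LITERAL-FIVE» (abc-iut-plan g12 ruling C-R110 (m); the orphan level named by
abc-iut-W-num-5 g5's engine-C axis list, STATUS 2026-08-27T09:17:13Z «2⁷23⁸ — literal l = 5»; HOME/plan/rescue/R-W/AXIS-TODO.tsv: REF residue `[5, 5]`,
everything else on this axis covered — REF ∀T `7 ≤ l ≤ 23433, l ≠ 19` by abc-iut-W-num-6's generated band `RefBandsExact10023806115968`
(`GenuineK.not_pilotKummerCompatHull_chosen_triple_10023806115968_band`), the type-split pair `RefBandsExactType…` / `RefBandsInhTypeBand…`, INH ∀T from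
`46897` by `RefBandsInhBand10023806115968`). THIS FILE decides the one prime the band starts above, with the SAME engine BY NAME: abc-iut-W-neg-1's
class-robust tame socket with the SHARP kernel class (`Cor312LicenceTripleHullCellRefuteTameSharp` §2: the three W-lane shapes
`WRow.not_licence_triple_of_hullCells_tameSharp` / `WRow.not_exists_qPinned_and_hull_triple_of_hullCells_tameSharp` /
`GenuineK.not_pilotKummerCompatHull_chosen_triple_of_hullCells_tameSharp`) at the tame pole `p = 19` (`19⁹ ∥ abc`, `v = 9` odd, `3 ∣ v` ⇒ class
`A ∈ {5, 10}`, `e = A·l`), TOP label `j = 2 = (5 − 1)/2`, turning point `a₀ = 1` (`18 < 5A ≤ 18·19`), and R-H row 4's EXACT integer cell `HullCell`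
decided by `decide` for both members: `A = 5`: `25·⌊(4·45 − 2·24 − 3·2)/25⌋ = 125 > 45 + 3·6 = 63`; `A = 10`: `50·⌊(4·90 − 2·49 − 3·3)/50⌋ = 250 >
90 + 3·31 = 183` (inner radius `⌊5A/18⌋ + 1 = 2, 3`; outer exponent `19 − 5A = −6, −31`). Two desk engines agree (the R-W lead's sweep AXIS-SWEEP.tsv reads
`l = 5` on the refuted side; the band's own linear closed forms are valid from `l = 5`: module docstring of `RefBandsExact10023806115968`, pieces
`a₀ = 1 on [5, 68]` / `[5, 34]`). TAKES NO SIDE on [IUTchIII] Cor. 3.12 (S. Mochizuki, *Inter-universal Teichmüller theory III*, Cor. 3.12 p. 173–174;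
Step (xi-f) p. 184) or on any author; «refuted as typed» ≠ «refuted in print».

WHAT IS PROVED (namespace `Summit.ABC.IUTFork.Conditional`): `RefBand.cells_10023806115968_five` (the two exact cells), `RefBand.frey10023806115968_nineteen_fac`
(`v₁₉(abc) = 9`), **`WRow.not_licence_frey10023806115968_five`** (∀ realising ideles ¬Licence), **`WRow.not_exists_qPinned_and_hull_frey10023806115968_five`**
(branch C's antecedent FAILS, any columns), **`GenuineK.not_pilotKummerCompatHull_chosen_triple_10023806115968_five`** (K-line shape: CHOSEN ideles, pinned
reading — the instance shape of the band theorem one level down). AXIS READING: with the files of record this prime axis `l ≥ 5` carries a deciding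
theorem AS TYPED at every prime (REF `5 ≤ l ≤ 23433, l ≠ 19` + the per-type pair on the type-split band + INH ∀T from `46897`). HONEST SCOPE as in the
engine: SHARP reading; per-label licence STRONGER than print; admissibility / Szpiro-badness / (P6) of `(ratPoint (a/c), 5)` and NON-EMPTINESS of the
datum type NOT claimed (a «∀ T» statement is vacuous if no datum exists); nothing about the number-level `Cor22.Cor312AtDatum` or any author's intended
hull; typed ≠ proved; instantiated ≠ endorsed; no abc claim.
[cite: Mochizuki2012, IUTchI Ex. 3.2 (iv) p. 71; IUTchIII Cor. 3.12 Step (xi-d) p. 183, (xi-f) p. 184; IUTchIV Prop. 1.1 p. 9, Prop. 1.2 (i)(ii) p. 10, Thm. 1.10 p. 22, Cor. 2.2 (ii) proof (P5) p. 46]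
[cite: DupuyHilado2025, §3.3, §3.4, §4.9, §4.12] [cite: SilvermanATAEC1994, V.5 Thm. 5.3 and Cor. 5.4] [claim: Mochizuki2012, status: disputed] for every IUT sentence quoted.
-/

noncomputable section

open Set Function NumberField IsDedekindDomain

namespace Summit.ABC.IUTFork.Conditional

open Thm311 Thm311.Real Cor312 Cor312Vol Cor312Prov Literature.IUT.LogThetaLattice Literature.IUT.LogVolume
  Literature.IUT.HodgeTheaters Literature.IUT.LogVolume.ThetaData Literature.IUT.LogVolume.Cor22
open Literature.NumberTheory.NumberFields Literature.NumberTheory.GaloisRepresentations.Ultrametric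
open Literature.NumberTheory.DiophantineGeometry Literature.NumberTheory.DiophantineGeometry.GenEll Summit.ABC.ABC.Theorems
open Summit.ABC.IUTFork.Repair.RH.HullThresholdExact

/-! ## §1. The integer side at `p = 19` (`v = 9`), `l = 5`, top label `j = 2`: class `A ∈ {5, 10}`, two exact cells -/

/-- **The engine's `hcell` for `2⁷·23⁸ + 19⁹·857² = 3²²·13·47²·263` at `p = 19` (`v = 9`), `l = 5`, top label `i + 1 = 2`.** The class clauses leave
`A ∈ {5, 10}`; for each member the turning point is `a₀ = 1` and R-H row 4's exact cell `HullCell (5A) (9A) 2 (⌊5A/18⌋ + 1) (19 − 5A)` FAILS (`decide`):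
`125 > 63`, `250 > 183`. [folklore] -/
theorem RefBand.cells_10023806115968_five (A : ℕ) (hA30 : A ∣ 30) (hA15 : 15 ∣ A * 9) (_hAev : Even 9 → A ∣ 15)
    (hA3 : 3 ∣ 9 → A ∣ 10) (_hA5 : 5 ∣ 9 → A ∣ 6) :
    ∃ a₀ : ℕ, (∀ s : ℕ, s < a₀ → (1 : ℤ) * ((19 : ℕ) : ℤ) ^ s * (((19 : ℕ) : ℤ) - 1) < ((A * 5 : ℕ) : ℤ)) ∧
      ((A * 5 : ℕ) : ℤ) ≤ 1 * ((19 : ℕ) : ℤ) ^ a₀ * (((19 : ℕ) : ℤ) - 1) ∧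
      ¬ HullCell ((A * 5 : ℕ) : ℤ) ((A * 9 : ℕ) : ℤ) (((1 : ℕ) : ℤ) + 1) (((A * 5) / ((19 : ℕ) - 1) + 1 : ℕ) : ℤ)
        (((19 : ℕ) : ℤ) ^ a₀ - (a₀ : ℤ) * ((A * 5 : ℕ) : ℤ)) := by
  have hA : A = 5 ∨ A = 10 := by
    have hA31 : A ≤ 30 := Nat.le_of_dvd (by norm_num) hA30
    interval_cases A <;> first | decide | omega
  rcases hA with rfl | rfl
  · -- member `A = 5`: `e = 25`, `m = 45`, `r_in = 2`, `r_out = 19 − 25`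
    refine ⟨1, fun s hs => ?_, ?_, ?_⟩
    · interval_cases s; norm_num
    · norm_num
    · unfold HullCell; decide
  · -- member `A = 10`: `e = 50`, `m = 90`, `r_in = 3`, `r_out = 19 − 50`
    refine ⟨1, fun s hs => ?_, ?_, ?_⟩
    · interval_cases s; norm_num
    · norm_num
    · unfold HullCell; decide

/-- `v₁₉(abc) = 9` for this triple (`19⁹ ∥ abc`), in the engine's `Nat.Primes` spelling. [folklore] -/
theorem RefBand.frey10023806115968_nineteen_fac :
    (2 ^ 7 * 23 ^ 8 * (19 ^ 9 * 857 ^ 2) * (3 ^ 22 * 13 * 47 ^ 2 * 263)).factorization ((⟨19, by norm_num⟩ : Nat.Primes) : ℕ) = 9 := by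
  have hp : Nat.Prime 19 := by norm_num
  have hn : 2 ^ 7 * 23 ^ 8 * (19 ^ 9 * 857 ^ 2) * (3 ^ 22 * 13 * 47 ^ 2 * 263) = 19 ^ 9 * 1744844473102715413709194121120754048 := by norm_num
  have hm : ¬ 19 ∣ 1744844473102715413709194121120754048 := by norm_num
  show (2 ^ 7 * 23 ^ 8 * (19 ^ 9 * 857 ^ 2) * (3 ^ 22 * 13 * 47 ^ 2 * 263)).factorization 19 = 9
  rw [hn, Nat.factorization_mul (pow_ne_zero _ hp.ne_zero) (by norm_num), Finsupp.add_apply, hp.factorization_pow,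
    Finsupp.single_eq_same, Nat.factorization_eq_zero_of_not_dvd hm, add_zero]

/-! ## §2. The three W-lane shapes at `l = 5` -/

/-- **THE HULL LICENCE FAILS at every genuine Θ-volume datum over `(ratPoint (2⁷23⁸/3²²13·47²263), 5)`**, for EVERY pair of Θ- and q-ideles realising the
pilot divisors of `pilotDataOfK T.D T.K` (setting-forming side conditions only): W-neg-1's tame-sharp socket at `p = 19`, top label, `RefBand.cells_10023806115968_five`.
NON-EMPTINESS of the datum type at `l = 5` is NOT claimed. [cite: Mochizuki2012, IUTchIII Cor. 3.12 Step (xi-f) p. 184; IUTchIV Thm. 1.10 p. 22, Cor. 2.2 (ii) proof (P5) p. 46]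
[cite: DupuyHilado2025, §3.4, §4.9, §4.12] [claim: Mochizuki2012, status: disputed] -/
theorem WRow.not_licence_frey10023806115968_five (T : Cor22.ThetaVolumeDatumAt (ratPoint (((2 ^ 7 * 23 ^ 8 : ℕ) : ℚ) / (3 ^ 22 * 13 * 47 ^ 2 * 263 : ℕ))) 5) :
    letI := T.instFieldF; letI := T.instNumberFieldF; letI := T.instAlgebraF; letI := T.instFieldK
    letI := T.instNumberFieldK; letI := T.instAlgebraK; letI := T.instFieldFbar; letI := T.instAlgebraFbar
    letI := T.instAlgebraKFbar; letI := T.instIsElliptic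
    ∀ {logv : PadicLogs T.K} (hlog : LogvAnalytic logv) (M : Type) [Field M] [NumberField M]
      (archPk : ∀ (j : (thetaIndex (pilotDataOfK T.D T.K)).Label) (vQ : (thetaIndex (pilotDataOfK T.D T.K)).VQ),
        Set ((logShellsDH (pilotDataOfK T.D T.K) logv).Packet j vQ))
      (archSub : ∀ (j : (thetaIndex (pilotDataOfK T.D T.K)).Label) (v : (thetaIndex (pilotDataOfK T.D T.K)).V),
        Set ((logShellsDH (pilotDataOfK T.D T.K) logv).Packet j ((thetaIndex (pilotDataOfK T.D T.K)).over v)))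
      (Ψ : ℤ → ∀ v : (thetaIndex (pilotDataOfK T.D T.K)).V, v ∈ (thetaIndex (pilotDataOfK T.D T.K)).Vbad →
        Set ((logShellsDH (pilotDataOfK T.D T.K) logv).StarPacket v))
      (act : ℤ → ∀ v : (thetaIndex (pilotDataOfK T.D T.K)).V, v ∈ (thetaIndex (pilotDataOfK T.D T.K)).Vbad →
        (logShellsDH (pilotDataOfK T.D T.K) logv).StarPacket v → Module.End ℚ ((logShellsDH (pilotDataOfK T.D T.K) logv).StarPacket v))
      (Mmod : ℤ → ∀ j : (thetaIndex (pilotDataOfK T.D T.K)).LabelStar, Set ((logShellsDH (pilotDataOfK T.D T.K) logv).GlobalPacket j.1))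
      (region : ℤ → ∀ j : (thetaIndex (pilotDataOfK T.D T.K)).LabelStar, FinDivisor M → ∀ vQ : (thetaIndex (pilotDataOfK T.D T.K)).VQ,
        Set ((logShellsDH (pilotDataOfK T.D T.K) logv).Packet j.1 vQ))
      (n : ℤ) {HT : Type} {LogLink : HT → HT → Type} {IsFull : ∀ {s t : HT}, LogLink s t → Prop}
      (lat : LGPGaussianLogThetaLattice LogLink IsFull)
      {Frd : Type} {IsoF : Frd → Frd → Type} {Ob : Frd → Type} {realify : Frd → Frd} {Strip : Type}
      {IsoS : Strip → Strip → Type} {Mv : ∀ v : (thetaIndex (pilotDataOfK T.D T.K)).V, v ∈ (thetaIndex (pilotDataOfK T.D T.K)).Vbad → Type}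
      [∀ v h, Monoid (Mv v h)]
      (sig : GlobalLGPFrobenioidSignature (thetaIndex (pilotDataOfK T.D T.K)).lstar (thetaIndex (pilotDataOfK T.D T.K)).V
        (· ∈ (thetaIndex (pilotDataOfK T.D T.K)).Vbad) Frd IsoF Ob realify Strip IsoS Mv)
      (split : SplittingMonoids Mv) {ObΔ : Type} {N : ∀ v : (thetaIndex (pilotDataOfK T.D T.K)).V, v ∈ (thetaIndex (pilotDataOfK T.D T.K)).Vbad → Type}
      [∀ v h, Monoid (N v h)] (qData : QPilotData ObΔ N)
      (tq : ∀ (pp : Nat.Primes) (x : (thetaIndex (pilotDataOfK T.D T.K)).Fibre (.inr pp)),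
        haveI : Fact (pp : ℕ).Prime := ⟨pp.2⟩; kOf (pilotDataOfK T.D T.K) pp.1 x)
      (t : ∀ (pp : Nat.Primes) (_ : Fin (pilotDataOfK T.D T.K).lstar) (x : (thetaIndex (pilotDataOfK T.D T.K)).Fibre (.inr pp)),
        haveI : Fact (pp : ℕ).Prime := ⟨pp.2⟩; kOf (pilotDataOfK T.D T.K) pp.1 x)
      (htq0 : ∀ pp x, tq pp x ≠ 0)
      (htq1 : ∀ (pp : Nat.Primes) (x : (thetaIndex (pilotDataOfK T.D T.K)).Fibre (.inr pp)),
        haveI : Fact (pp : ℕ).Prime := ⟨pp.2⟩; placeOf (pilotDataOfK T.D T.K) pp.1 x ∉ (pilotDataOfK T.D T.K).S → ‖tq pp x‖ = 1)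
      (_ht0 : ∀ pp i x, t pp i x ≠ 0)
      (_ht : ∀ (pp : Nat.Primes) (i : Fin (pilotDataOfK T.D T.K).lstar) (x : (thetaIndex (pilotDataOfK T.D T.K)).Fibre (.inr pp)),
        haveI : Fact (pp : ℕ).Prime := ⟨pp.2⟩
        Real.log ‖t pp i x‖ = -((pilotDataOfK T.D T.K).thetaPilot i (placeOf (pilotDataOfK T.D T.K) pp.1 x)) *
          logNorm T.K (placeOf (pilotDataOfK T.D T.K) pp.1 x) / localDegree T.K (placeOf (pilotDataOfK T.D T.K) pp.1 x))
      (_htq : ∀ (pp : Nat.Primes) (x : (thetaIndex (pilotDataOfK T.D T.K)).Fibre (.inr pp)),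
        haveI : Fact (pp : ℕ).Prime := ⟨pp.2⟩
        Real.log ‖tq pp x‖ = -((pilotDataOfK T.D T.K).qPilot (placeOf (pilotDataOfK T.D T.K) pp.1 x)) *
          logNorm T.K (placeOf (pilotDataOfK T.D T.K) pp.1 x) / localDegree T.K (placeOf (pilotDataOfK T.D T.K) pp.1 x)),
      ¬ Thm311ToCor312.Licence
        (settingPrVolSharp (pilotDataOfK T.D T.K) hlog M archPk archSub Ψ act Mmod region n lat sig split qData tq t htq0 htq1) := by
  exact WRow.not_licence_triple_of_hullCells_tameSharp isABCTriple_frey10023806115968 T ⟨19, by norm_num⟩ (by norm_num) (by norm_num)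
    (by norm_num) (by norm_num) (by norm_num) RefBand.frey10023806115968_nineteen_fac (i := 1) (by norm_num)
    RefBand.cells_10023806115968_five

/-- **… hence branch C's per-datum antecedent «∃ ρ qK, QPinned ∧ PilotKummerCompatHull» FAILS** there (any `col`, every pair of realising ideles).
[cite: Mochizuki2012, IUTchIII Cor. 3.12 Step (xi-f) p. 184] [cite: DupuyHilado2025, §4.9] [claim: Mochizuki2012, status: disputed] -/
theorem WRow.not_exists_qPinned_and_hull_frey10023806115968_five (T : Cor22.ThetaVolumeDatumAt (ratPoint (((2 ^ 7 * 23 ^ 8 : ℕ) : ℚ) / (3 ^ 22 * 13 * 47 ^ 2 * 263 : ℕ))) 5) :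
    letI := T.instFieldF; letI := T.instNumberFieldF; letI := T.instAlgebraF; letI := T.instFieldK
    letI := T.instNumberFieldK; letI := T.instAlgebraK; letI := T.instFieldFbar; letI := T.instAlgebraFbar
    letI := T.instAlgebraKFbar; letI := T.instIsElliptic
    ∀ {logv : PadicLogs T.K} (hlog : LogvAnalytic logv) (M : Type) [Field M] [NumberField M]
      (archPk : ∀ (j : (thetaIndex (pilotDataOfK T.D T.K)).Label) (vQ : (thetaIndex (pilotDataOfK T.D T.K)).VQ),
        Set ((logShellsDH (pilotDataOfK T.D T.K) logv).Packet j vQ))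
      (archSub : ∀ (j : (thetaIndex (pilotDataOfK T.D T.K)).Label) (v : (thetaIndex (pilotDataOfK T.D T.K)).V),
        Set ((logShellsDH (pilotDataOfK T.D T.K) logv).Packet j ((thetaIndex (pilotDataOfK T.D T.K)).over v)))
      (Ψ : ℤ → ∀ v : (thetaIndex (pilotDataOfK T.D T.K)).V, v ∈ (thetaIndex (pilotDataOfK T.D T.K)).Vbad →
        Set ((logShellsDH (pilotDataOfK T.D T.K) logv).StarPacket v))
      (act : ℤ → ∀ v : (thetaIndex (pilotDataOfK T.D T.K)).V, v ∈ (thetaIndex (pilotDataOfK T.D T.K)).Vbad →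
        (logShellsDH (pilotDataOfK T.D T.K) logv).StarPacket v → Module.End ℚ ((logShellsDH (pilotDataOfK T.D T.K) logv).StarPacket v))
      (Mmod : ℤ → ∀ j : (thetaIndex (pilotDataOfK T.D T.K)).LabelStar, Set ((logShellsDH (pilotDataOfK T.D T.K) logv).GlobalPacket j.1))
      (region : ℤ → ∀ j : (thetaIndex (pilotDataOfK T.D T.K)).LabelStar, FinDivisor M → ∀ vQ : (thetaIndex (pilotDataOfK T.D T.K)).VQ,
        Set ((logShellsDH (pilotDataOfK T.D T.K) logv).Packet j.1 vQ))
      (n : ℤ) {HT : Type} {LogLink : HT → HT → Type} {IsFull : ∀ {s t : HT}, LogLink s t → Prop}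
      (lat : LGPGaussianLogThetaLattice LogLink IsFull)
      {Frd : Type} {IsoF : Frd → Frd → Type} {Ob : Frd → Type} {realify : Frd → Frd} {Strip : Type}
      {IsoS : Strip → Strip → Type} {Mv : ∀ v : (thetaIndex (pilotDataOfK T.D T.K)).V, v ∈ (thetaIndex (pilotDataOfK T.D T.K)).Vbad → Type}
      [∀ v h, Monoid (Mv v h)]
      (sig : GlobalLGPFrobenioidSignature (thetaIndex (pilotDataOfK T.D T.K)).lstar (thetaIndex (pilotDataOfK T.D T.K)).V
        (· ∈ (thetaIndex (pilotDataOfK T.D T.K)).Vbad) Frd IsoF Ob realify Strip IsoS Mv)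
      (split : SplittingMonoids Mv) {ObΔ : Type} {N : ∀ v : (thetaIndex (pilotDataOfK T.D T.K)).V, v ∈ (thetaIndex (pilotDataOfK T.D T.K)).Vbad → Type}
      [∀ v h, Monoid (N v h)] (qData : QPilotData ObΔ N)
      (tq : ∀ (pp : Nat.Primes) (x : (thetaIndex (pilotDataOfK T.D T.K)).Fibre (.inr pp)),
        haveI : Fact (pp : ℕ).Prime := ⟨pp.2⟩; kOf (pilotDataOfK T.D T.K) pp.1 x)
      (t : ∀ (pp : Nat.Primes) (_ : Fin (pilotDataOfK T.D T.K).lstar) (x : (thetaIndex (pilotDataOfK T.D T.K)).Fibre (.inr pp)),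
        haveI : Fact (pp : ℕ).Prime := ⟨pp.2⟩; kOf (pilotDataOfK T.D T.K) pp.1 x)
      (htq0 : ∀ pp x, tq pp x ≠ 0)
      (htq1 : ∀ (pp : Nat.Primes) (x : (thetaIndex (pilotDataOfK T.D T.K)).Fibre (.inr pp)),
        haveI : Fact (pp : ℕ).Prime := ⟨pp.2⟩; placeOf (pilotDataOfK T.D T.K) pp.1 x ∉ (pilotDataOfK T.D T.K).S → ‖tq pp x‖ = 1)
      (col : ℤ → Column (logShellsDH (pilotDataOfK T.D T.K) logv))
      (_ht0 : ∀ pp i x, t pp i x ≠ 0)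
      (_ht : ∀ (pp : Nat.Primes) (i : Fin (pilotDataOfK T.D T.K).lstar) (x : (thetaIndex (pilotDataOfK T.D T.K)).Fibre (.inr pp)),
        haveI : Fact (pp : ℕ).Prime := ⟨pp.2⟩
        Real.log ‖t pp i x‖ = -((pilotDataOfK T.D T.K).thetaPilot i (placeOf (pilotDataOfK T.D T.K) pp.1 x)) *
          logNorm T.K (placeOf (pilotDataOfK T.D T.K) pp.1 x) / localDegree T.K (placeOf (pilotDataOfK T.D T.K) pp.1 x))
      (_htq : ∀ (pp : Nat.Primes) (x : (thetaIndex (pilotDataOfK T.D T.K)).Fibre (.inr pp)),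
        haveI : Fact (pp : ℕ).Prime := ⟨pp.2⟩
        Real.log ‖tq pp x‖ = -((pilotDataOfK T.D T.K).qPilot (placeOf (pilotDataOfK T.D T.K) pp.1 x)) *
          logNorm T.K (placeOf (pilotDataOfK T.D T.K) pp.1 x) / localDegree T.K (placeOf (pilotDataOfK T.D T.K) pp.1 x)),
      ¬ ∃ (ρ : (∀ v : (thetaIndex (pilotDataOfK T.D T.K)).V, v ∈ (thetaIndex (pilotDataOfK T.D T.K)).Vbad →
              Set ((logShellsDH (pilotDataOfK T.D T.K) logv).StarPacket v)) →
            ∀ (j : (thetaIndex (pilotDataOfK T.D T.K)).Label) (vQ : (thetaIndex (pilotDataOfK T.D T.K)).VQ),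
              Set ((logShellsDH (pilotDataOfK T.D T.K) logv).Packet j vQ))
          (qK : ∀ v : (thetaIndex (pilotDataOfK T.D T.K)).V, v ∈ (thetaIndex (pilotDataOfK T.D T.K)).Vbad →
            Set ((logShellsDH (pilotDataOfK T.D T.K) logv).StarPacket v)),
          QPinned ({ toSituation := situationPrVol (pilotDataOfK T.D T.K) hlog M archPk archSub Ψ act Mmod region, col := col } :
              LatticeSituation (thetaIndex (pilotDataOfK T.D T.K)))
            (settingPrVolSharp (pilotDataOfK T.D T.K) hlog M archPk archSub Ψ act Mmod region n lat sig split qData tq t htq0 htq1) ρ qK ∧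
          PilotKummerCompatHull ({ toSituation := situationPrVol (pilotDataOfK T.D T.K) hlog M archPk archSub Ψ act Mmod region, col := col } :
              LatticeSituation (thetaIndex (pilotDataOfK T.D T.K)))
            (settingPrVolSharp (pilotDataOfK T.D T.K) hlog M archPk archSub Ψ act Mmod region n lat sig split qData tq t htq0 htq1) ρ qK := by
  exact WRow.not_exists_qPinned_and_hull_triple_of_hullCells_tameSharp isABCTriple_frey10023806115968 T ⟨19, by norm_num⟩ (by norm_num) (by norm_num)
    (by norm_num) (by norm_num) (by norm_num) RefBand.frey10023806115968_nineteen_fac (i := 1) (by norm_num)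
    RefBand.cells_10023806115968_five

/-- **… and in the K-LINE SHAPE (CHOSEN realising ideles, PINNED reading)** — the instance shape of the band theorem
`GenuineK.not_pilotKummerCompatHull_chosen_triple_10023806115968_band` one prime below its range. [cite: Mochizuki2012, IUTchIII Cor. 3.12 Step (xi-f) p. 184]
[cite: DupuyHilado2025, §4.9] [claim: Mochizuki2012, status: disputed] -/
theorem GenuineK.not_pilotKummerCompatHull_chosen_triple_10023806115968_five (T : Cor22.ThetaVolumeDatumAt (ratPoint (((2 ^ 7 * 23 ^ 8 : ℕ) : ℚ) / (3 ^ 22 * 13 * 47 ^ 2 * 263 : ℕ))) 5) :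
    letI := T.instFieldF; letI := T.instNumberFieldF; letI := T.instAlgebraF; letI := T.instFieldK
    letI := T.instNumberFieldK; letI := T.instAlgebraK; letI := T.instFieldFbar; letI := T.instAlgebraFbar
    letI := T.instAlgebraKFbar; letI := T.instIsElliptic
    ∀ (M : Type) [Field M] [NumberField M]
      (archPk : ∀ (j : (thetaIndex (pilotDataOfK T.D T.K)).Label) (vQ : (thetaIndex (pilotDataOfK T.D T.K)).VQ),
        Set ((logShellsDH (pilotDataOfK T.D T.K) (analyticLogv T.K)).Packet j vQ))
      (archSub : ∀ (j : (thetaIndex (pilotDataOfK T.D T.K)).Label) (v : (thetaIndex (pilotDataOfK T.D T.K)).V),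
        Set ((logShellsDH (pilotDataOfK T.D T.K) (analyticLogv T.K)).Packet j ((thetaIndex (pilotDataOfK T.D T.K)).over v)))
      (Ψ : ℤ → ∀ v : (thetaIndex (pilotDataOfK T.D T.K)).V, v ∈ (thetaIndex (pilotDataOfK T.D T.K)).Vbad →
        Set ((logShellsDH (pilotDataOfK T.D T.K) (analyticLogv T.K)).StarPacket v))
      (act : ℤ → ∀ v : (thetaIndex (pilotDataOfK T.D T.K)).V, v ∈ (thetaIndex (pilotDataOfK T.D T.K)).Vbad →
        (logShellsDH (pilotDataOfK T.D T.K) (analyticLogv T.K)).StarPacket v →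
          Module.End ℚ ((logShellsDH (pilotDataOfK T.D T.K) (analyticLogv T.K)).StarPacket v))
      (Mmod : ℤ → ∀ j : (thetaIndex (pilotDataOfK T.D T.K)).LabelStar, Set ((logShellsDH (pilotDataOfK T.D T.K) (analyticLogv T.K)).GlobalPacket j.1))
      (region : ℤ → ∀ j : (thetaIndex (pilotDataOfK T.D T.K)).LabelStar, FinDivisor M → ∀ vQ : (thetaIndex (pilotDataOfK T.D T.K)).VQ,
        Set ((logShellsDH (pilotDataOfK T.D T.K) (analyticLogv T.K)).Packet j.1 vQ))
      (frobAdm : ℤ → ℤ → ∀ (j : (thetaIndex (pilotDataOfK T.D T.K)).Label) (vQ : (thetaIndex (pilotDataOfK T.D T.K)).VQ),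
        Set ((logShellsDH (pilotDataOfK T.D T.K) (analyticLogv T.K)).Packet j vQ) → Prop)
      (frobLogvol : ℤ → ℤ → ∀ (j : (thetaIndex (pilotDataOfK T.D T.K)).Label) (vQ : (thetaIndex (pilotDataOfK T.D T.K)).VQ),
        Set ((logShellsDH (pilotDataOfK T.D T.K) (analyticLogv T.K)).Packet j vQ) → ℝ)
      (frobΨ : ℤ → ℤ → ∀ v : (thetaIndex (pilotDataOfK T.D T.K)).V, v ∈ (thetaIndex (pilotDataOfK T.D T.K)).Vbad →
        Set ((logShellsDH (pilotDataOfK T.D T.K) (analyticLogv T.K)).StarPacket v))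
      (frobMmod : ℤ → ℤ → ∀ j : (thetaIndex (pilotDataOfK T.D T.K)).LabelStar, Set ((logShellsDH (pilotDataOfK T.D T.K) (analyticLogv T.K)).GlobalPacket j.1))
      (unitImage : ℤ → ℤ → ℕ → ∀ (j : (thetaIndex (pilotDataOfK T.D T.K)).Label) (vQ : (thetaIndex (pilotDataOfK T.D T.K)).VQ),
        Set ((logShellsDH (pilotDataOfK T.D T.K) (analyticLogv T.K)).Packet j vQ))
      (ballImage : ℤ → ℤ → ∀ (j : (thetaIndex (pilotDataOfK T.D T.K)).Label) (vQ : (thetaIndex (pilotDataOfK T.D T.K)).VQ),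
        Set ((logShellsDH (pilotDataOfK T.D T.K) (analyticLogv T.K)).Packet j vQ))
      (thetaDiv : ℤ → ℤ → LgpDivisor M (thetaIndex (pilotDataOfK T.D T.K)).lstar)
      (n : ℤ) {HT : Type} {LogLink : HT → HT → Type} {IsFull : ∀ {s t : HT}, LogLink s t → Prop}
      (lat : LGPGaussianLogThetaLattice LogLink IsFull)
      {Frd : Type} {IsoF : Frd → Frd → Type} {Ob : Frd → Type} {realify : Frd → Frd} {Strip : Type}
      {IsoS : Strip → Strip → Type} {Mv : ∀ v : (thetaIndex (pilotDataOfK T.D T.K)).V, v ∈ (thetaIndex (pilotDataOfK T.D T.K)).Vbad → Type}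
      [∀ v h, Monoid (Mv v h)]
      (sig : GlobalLGPFrobenioidSignature (thetaIndex (pilotDataOfK T.D T.K)).lstar (thetaIndex (pilotDataOfK T.D T.K)).V
        (· ∈ (thetaIndex (pilotDataOfK T.D T.K)).Vbad) Frd IsoF Ob realify Strip IsoS Mv)
      (split : SplittingMonoids Mv) {ObΔ : Type} {N : ∀ v : (thetaIndex (pilotDataOfK T.D T.K)).V, v ∈ (thetaIndex (pilotDataOfK T.D T.K)).Vbad → Type}
      [∀ v h, Monoid (N v h)] (qData : QPilotData ObΔ N)
      (qK : ∀ v : (thetaIndex (pilotDataOfK T.D T.K)).V, v ∈ (thetaIndex (pilotDataOfK T.D T.K)).Vbad →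
        Set ((logShellsDH (pilotDataOfK T.D T.K) (analyticLogv T.K)).StarPacket v)),
      ¬ Cor312Vol.PilotKummerCompatHull
          (LatticeSituation.ofShells (logShellsDH (pilotDataOfK T.D T.K) (analyticLogv T.K)) M archPk archSub
            (summandPiecesPr (pilotDataOfK T.D T.K) (logvAnalytic_analyticLogv (F := T.K))).Adm
            (summandPiecesPr (pilotDataOfK T.D T.K) (logvAnalytic_analyticLogv (F := T.K))).logvol Ψ act Mmod region frobAdm frobLogvol frobΨ
            frobMmod unitImage ballImage thetaDiv)
          (settingPrVolSharp (pilotDataOfK T.D T.K) (logvAnalytic_analyticLogv (F := T.K)) M archPk archSub Ψ act Mmod region n lat sig split qData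
            (exists_realising_qIdeles_pilotDataOfK T.D).choose (exists_realising_thetaIdeles_pilotDataOfK T.D).choose
            (exists_realising_qIdeles_pilotDataOfK T.D).choose_spec.1 (exists_realising_qIdeles_pilotDataOfK T.D).choose_spec.2.1)
          (fun _ => Cor312.Setting.qRegion
            (settingPrVolSharp (pilotDataOfK T.D T.K) (logvAnalytic_analyticLogv (F := T.K)) M archPk archSub Ψ act Mmod region n lat sig split qData
              (exists_realising_qIdeles_pilotDataOfK T.D).choose (exists_realising_thetaIdeles_pilotDataOfK T.D).choose
              (exists_realising_qIdeles_pilotDataOfK T.D).choose_spec.1 (exists_realising_qIdeles_pilotDataOfK T.D).choose_spec.2.1)) qK := by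
  exact GenuineK.not_pilotKummerCompatHull_chosen_triple_of_hullCells_tameSharp isABCTriple_frey10023806115968 T ⟨19, by norm_num⟩ (by norm_num) (by norm_num)
    (by norm_num) (by norm_num) (by norm_num) RefBand.frey10023806115968_nineteen_fac (i := 1) (by norm_num)
    RefBand.cells_10023806115968_five

end Summit.ABC.IUTFork.Conditional

end
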